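import Summits.SmoothPoincare4.SmoothPoincare4.Theorems.CylinderEntropyCylinderRungTwoGaussianAreaLeCylDensity
import Summits.SmoothPoincare4.SmoothPoincare4.Theorems.CylinderEntropyCylinderRungTwoFluxIdentityGram
import Literature.Geometry.Riemannian.ColdingMinicozziEntropyDensity
import Literature.MeasureTheory.Hausdorff.SmoothImageHausdorffFinite
import Mathlib.Geometry.Manifold.SmoothEmbedding
import HarnessLib

/-!
# Route `CylinderEntropy`, crux `CylinderRungTwo` (stmt-SmoothPoincare4-7631), line `killing-flux`:
# the typed density of an embedded cross-section at one of its points has `liminf ≥ 1` as the scale `→ 0`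

Registered helper `helper_liminfCylDensityAtPoint` (lead c3, step H3 of the "unit lower density along
cylinder flows" chain).  For a smooth embedding `ι : M⁴ → N = S⁴ × ℝ ⊂ ℝ⁶` of a compact `4`-manifold
and `x₀ ∈ M`: for every `η > 0`, `1 - η ≤ F̂_{ι x₀, σ}(ι(M))` for all sufficiently small scales `σ > 0`.

Proof.  Colding–Minicozzi's Lemma 7.2 (3) (tree: `tendsto_gaussianArea_range_nhdsGT_zero`) gives
`F_{ι x₀, t}(ι(M)) → 1` for the EUCLIDEAN Gaussian areas of `ℝ⁶`; the landed density-level kernel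
domination for the inclusion `N ⊂ ℝ⁶` (`helper_gaussianAreaLeCylDensity`, Cheeger–Yau) bounds
`F_{y,t}(A) ≤ (1+δ) F̂_{y,(1+κ)t}(A) + δ · μH⁴(A)/μH⁴(S⁴)` for centres `y ∈ N` and small `t`, with
`0 ≤ κ ≤ δ`; choosing `δ = min 1 (η/(r+3))`, `r = μH⁴(ι M)/μH⁴(S⁴) < ∞`, and reparametrising
`σ = (1+κ)t` gives the claim.  Everything is PROVED (no `sorry`, no definitions, no named facts).
-/

noncomputable section

-- the prescribed namespace `Summit.SmoothPoincare4.SmoothPoincare4.…` repeats `SmoothPoincare4`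
set_option linter.dupNamespace false

open MeasureTheory Set Filter
open scoped Manifold ContDiff ENNReal NNReal Topology BigOperators

namespace Summit.SmoothPoincare4.SmoothPoincare4.Cruxes.CylinderRungTwo.KillingFlux

open Literature.Geometry.Riemannian
open Literature.Geometry.Riemannian.SphericalCylinderEntropy (cylEntropy cylDensity cylKernel truncL
  hausdorffMeasure_sphere_four_pos hausdorffMeasure_sphere_four_lt_top)

/-- **Colding–Minicozzi 2012, Lemma 7.2 (3) for cross-sections of `N ⊂ ℝ⁶`**: for a compact `C^∞`
`4`-manifold `M`, a `C^∞` embedding `ι : M → ℝ⁶` and `x₀ ∈ M`, the Euclidean Gaussian areas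
`F_{ι x₀, t}(ι(M))` tend to `1` as `t → 0⁺`. [cite: ColdingMinicozzi2012, Lemma 7.2] -/
theorem tendsto_gaussianArea_range_of_isSmoothEmbedding_six
    (M : Type) [TopologicalSpace M] [CompactSpace M] [ChartedSpace (EuclideanSpace ℝ (Fin 4)) M]
    [IsManifold (𝓡 4) ∞ M] {ι : M → EuclideanSpace ℝ (Fin 6)}
    (hι : Manifold.IsSmoothEmbedding (𝓡 4) (𝓡 6) ∞ ι) (x₀ : M) :
    Filter.Tendsto (fun t : ℝ => gaussianArea 4 (ι x₀) t (range ι)) (𝓝[>] 0) (𝓝 1) :=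
  tendsto_gaussianArea_range_nhdsGT_zero (EM := EuclideanSpace ℝ (Fin 4))
    finrank_euclideanSpace_fin hι.contMDiff (by simp) hι.isEmbedding.injective x₀
    (Summit.SmoothPoincare4.SmoothPoincare4.Theorems.CylinderRungTwo.KillingFlux.mfderiv_injective_of_isSmoothEmbedding
      hι x₀)

/-- The image of a compact `4`-manifold under a smooth map into `ℝ⁶` has finite `μH[4]`-measure.
[cite: Federer1969, 2.10.11] -/
theorem hausdorffMeasure_range_lt_top_six
    (M : Type) [TopologicalSpace M] [CompactSpace M] [ChartedSpace (EuclideanSpace ℝ (Fin 4)) M]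
    {ι : M → EuclideanSpace ℝ (Fin 6)} (hι : Manifold.IsSmoothEmbedding (𝓡 4) (𝓡 6) ∞ ι) :
    μH[4] (range ι) < ⊤ :=
  Literature.MeasureTheory.Hausdorff.hausdorffMeasure_range_lt_top (E := EuclideanSpace ℝ (Fin 4))
    (I := 𝓡 4) hι.contMDiff (by simp) (d := 4) (by simp)

/-- Rescaling the right-neighbourhood filter of `0`: `σ ↦ σ / c` maps `𝓝[>] 0` to `𝓝[>] 0` for `c > 0`.
[folklore] -/
theorem tendsto_div_const_nhdsGT_zero {c : ℝ} (hc : 0 < c) :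
    Tendsto (fun σ : ℝ => σ / c) (𝓝[>] (0 : ℝ)) (𝓝[>] (0 : ℝ)) := by
  refine tendsto_nhdsWithin_iff.2 ⟨?_, ?_⟩
  · have h : Tendsto (fun σ : ℝ => σ / c) (𝓝 (0 : ℝ)) (𝓝 (0 / c)) :=
      (continuous_id.div_const c).tendsto 0
    rw [zero_div] at h
    exact h.mono_left nhdsWithin_le_nhds
  · filter_upwards [self_mem_nhdsWithin] with σ (hσ : 0 < σ)
    exact div_pos hσ hc

/-- **Registered helper `helper_liminfCylDensityAtPoint` (H3).**  For a smooth embedding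
`ι : M → N = S⁴ × ℝ` of a compact `4`-manifold and `x₀ ∈ M`: for every `η > 0`, eventually as `σ → 0⁺`,
`1 - η ≤ F̂_{ι x₀, σ}(ι(M))` (typed slice-normalised density).  Euclidean Gaussian density `→ 1`
(Colding–Minicozzi 7.2 (3)) + density-level kernel domination for the inclusion (Cheeger–Yau) +
rescaling of the scale. [cite: ColdingMinicozzi2012, Lemma 7.2] -/
theorem helper_liminfCylDensityAtPoint : ∀ (M : Type) [TopologicalSpace M] [T2Space M] [SecondCountableTopology M] [ChartedSpace (EuclideanSpace ℝ (Fin 4)) M] [IsManifold (𝓡 4) ∞ M] [CompactSpace M] (ι : M → EuclideanSpace ℝ (Fin 6)), Manifold.IsSmoothEmbedding (𝓡 4) (𝓡 6) ∞ ι → (∀ x, ∑ i : Fin 5, ι x (Fin.castSucc i) ^ 2 = 1) → ∀ (x₀ : M) (η : ℝ), 0 < η → ∀ᶠ σ in 𝓝[>] (0 : ℝ), ENNReal.ofReal (1 - η) ≤ cylDensity (Set.range ι) (ι x₀) σ := by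
  intro M _ _ _ _ _ _ ι hι hN x₀ η hη
  -- the trivial case `η ≥ 1`
  rcases le_or_gt 1 η with hη1 | hη1
  · refine Filter.Eventually.of_forall fun σ => ?_
    rw [ENNReal.ofReal_of_nonpos (by linarith)]
    exact bot_le
  -- the set `A = ι(M) ⊆ N` and its finite area ratio `r`
  set A : Set (EuclideanSpace ℝ (Fin 6)) := range ι with hA
  have hAN : ∀ z ∈ A, ∑ i : Fin 5, z (Fin.castSucc i) ^ 2 = 1 := by
    rintro _ ⟨x, rfl⟩; exact hN x
  have hAc : IsCompact A := isCompact_range hι.contMDiff.continuous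
  have hAm : MeasurableSet A := hAc.isClosed.measurableSet
  have hAfin : μH[4] A < ⊤ := hausdorffMeasure_range_lt_top_six M hι
  set S : ℝ≥0∞ := μH[4] (Metric.sphere (0 : EuclideanSpace ℝ (Fin 5)) 1) with hS
  have hS0 : S ≠ 0 := hausdorffMeasure_sphere_four_pos.ne'
  have hStop : S ≠ ⊤ := hausdorffMeasure_sphere_four_lt_top.ne
  set R : ℝ≥0∞ := S⁻¹ * μH[4] A with hR
  have hRtop : R ≠ ⊤ := ENNReal.mul_ne_top (ENNReal.inv_ne_top.2 hS0) hAfin.ne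
  set r : ℝ := R.toReal with hr
  have hr0 : 0 ≤ r := ENNReal.toReal_nonneg
  have hRr : R = ENNReal.ofReal r := (ENNReal.ofReal_toReal hRtop).symm
  -- the constant `δ`
  set δ : ℝ := min 1 (η / (r + 3)) with hδ
  have hδpos : 0 < δ := lt_min one_pos (div_pos hη (by linarith))
  have hδ1 : δ ≤ 1 := min_le_left _ _
  have hδη : δ ≤ η / (r + 3) := min_le_right _ _
  have hδr : δ * (r + 3) ≤ η := by rwa [le_div_iff₀ (by linarith)] at hδη
  -- kernel domination and Euclidean density
  obtain ⟨κ, hκ0, hκδ, t₁, ht₁, hdom⟩ := helper_gaussianAreaLeCylDensity δ hδpos hδ1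
  have hG := tendsto_gaussianArea_range_of_isSmoothEmbedding_six M hι x₀
  have hev1 : ∀ᶠ t in 𝓝[>] (0 : ℝ), ENNReal.ofReal (1 - δ) < gaussianArea 4 (ι x₀) t A := by
    refine (tendsto_order.1 hG).1 _ ?_
    rw [← ENNReal.ofReal_one]
    exact (ENNReal.ofReal_lt_ofReal_iff one_pos).2 (by linarith)
  have hev2 : ∀ᶠ t in 𝓝[>] (0 : ℝ), t ≤ t₁ := by
    have h : Set.Iio t₁ ∈ 𝓝 (0 : ℝ) := Iio_mem_nhds ht₁
    filter_upwards [mem_nhdsWithin_of_mem_nhds h] with t ht using le_of_lt ht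
  -- at scale `(1+κ) t` the typed density is `≥ 1 - η`
  have key : ∀ᶠ t in 𝓝[>] (0 : ℝ),
      ENNReal.ofReal (1 - η) ≤ cylDensity A (ι x₀) ((1 + κ) * t) := by
    filter_upwards [hev1, hev2, self_mem_nhdsWithin] with t h1 h2 ht
    have ht0 : 0 < t := ht
    have h := hdom A hAN hAm (ι x₀) (hN x₀) t ht0 h2
    by_contra hlt
    push Not at hlt
    -- then the Gaussian area would be `< (1+δ)(1-η) + δ r`, contradicting `h1`
    have hle : gaussianArea 4 (ι x₀) t A ≤
        ENNReal.ofReal (1 + δ) * ENNReal.ofReal (1 - η) + ENNReal.ofReal δ * R := by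
      refine h.trans ?_
      gcongr
    have hsum : ENNReal.ofReal (1 + δ) * ENNReal.ofReal (1 - η) + ENNReal.ofReal δ * R =
        ENNReal.ofReal ((1 + δ) * (1 - η) + δ * r) := by
      rw [hRr, ← ENNReal.ofReal_mul (by linarith), ← ENNReal.ofReal_mul hδpos.le,
        ← ENNReal.ofReal_add (by nlinarith) (by nlinarith)]
    have hlt' : ENNReal.ofReal (1 - δ) < ENNReal.ofReal ((1 + δ) * (1 - η) + δ * r) := by
      rw [← hsum]; exact h1.trans_le hle
    rw [ENNReal.ofReal_lt_ofReal_iff_of_nonneg (by linarith)] at hlt'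
    nlinarith
  -- rescale `σ = (1+κ) t`
  have hκ1 : 0 < 1 + κ := by linarith
  have hmap := tendsto_div_const_nhdsGT_zero hκ1
  have key' := hmap.eventually key
  filter_upwards [key'] with σ hσ
  have hσeq : (1 + κ) * (σ / (1 + κ)) = σ := mul_div_cancel₀ σ hκ1.ne'
  rwa [hσeq] at hσ

end Summit.SmoothPoincare4.SmoothPoincare4.Cruxes.CylinderRungTwo.KillingFlux

end
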